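import Summits.QuantumFields.BalabanUV.Beta.RemainderExplicitHistoryDiagonalExistence

/-!
# RemainderExplicitHistoryDiagonalEventual — ROAD P3: the diagonal summation of station S-d4p3-g47-1 with node U2 v1.1's EVENTUAL floor
# `EventualLowerH b γ k₀ β` in place of the all-k floor `BetaLowerH b γ β`: the first `k₀` ultraviolet columns of the history feedback are
# absorbed into the source with an A-PRIORI sup bound `disc ≤ S∕(1 − WU)` (`U = (k₀+1)γ³ + 2γ∕b`, node U2's K-uniform weight sum), after
# which `RemainderExplicitHistoryDiagonalKernel.diag_sum_le` applies unchanged: `Σ_{n<N} disc ≤ m·(S + k₀Wγ³·S∕(1 − WU))∕(1 − Wγ∕b)` and the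
# continuum coupling exists scale by scale — still NO NE4 as typed, NO `FadingMemory` (fifth file of the station; optional strengthening)

Cell `pub-balaban`, β-function sub-cell, BINDER row D4 «RemainderConst leaves for Bałaban's split» (`HOME/BINDER-OWNERS.md`; owner
lineage `b2b-balaban-beta-an4`; this file by co-owner #3 lineage `b2b-balaban-beta-d4-p3`, road P3 «the reduction road», generation 47,
station S-d4p3-g47-1, fifth file; imports the station's `RemainderExplicitHistoryDiagonalExistence`), β-FLOW TEAM duty (1); FREEZE (0)
honoured (def-free module in road P3's own `RemainderExplicit*` series; no leaf, no interface, no Literature file).  SOURCE OF THE SHAPES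
ONLY: [Balaban1987RG1] (0.20) p. 256, (0.31) and Thm 2 p. 259, §1 p. 264, §5 p. 298.  Pure real analysis (finite sums).

HONEST FRAMING (page 1 of everything the β sub-cell writes).  *"Discharging BetaPertH makes Bałaban's UV stability UNCONDITIONAL —
a real constructive-QFT result; it is NOT the continuum limit and NOT the Clay problem."*  THIS FILE DISCHARGES NOTHING OF THE
KIND.  The station's END `RemainderExplicitHistoryDiagonalSum.sum_disc_diag_le` consumes the asymptotic-freedom floor in the ALL-k form
`BetaLowerH b γ β`; the β sub-cell's limit form supplies only the EVENTUAL floor `EventualLowerH b γ k₀ β` (`b ≤ β_{k+1}` for `k ≥ k₀`;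
node U2 v1.1, `T4CouplingMatching.injectedRate_of_runs_eventual`; no small-k sign of the β-functions).  On the first `k₀` scales only the
box bound `(g^A_i)²g^B_{i+1} ≤ γ³` is available and `n·u_n` is unbounded there, so the kernel does not apply verbatim; this file removes the
obstruction: the sup of the discrepancies over one pinned pair of runs is a-priori `≤ S∕(1 − WU)` (smallness `WU < 1`, `U = (k₀+1)γ³ + 2γ∕b`
BY NAME from node U2's `sum_weights_le_of_eventualLower`), the `k₀` ultraviolet columns then contribute a second summable SOURCE
(`≤ k₀·W·γ³·S∕(1 − WU)` in total), and the remaining columns carry the asymptotic-freedom weights of infrared distance.  Every hypothesis on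
`β` is an UNPRINTED SHAPE ([Balaban1987RG1] p. 264, p. 298; [Balaban1989LargeFieldII] p. 355: the β-function paper "has not been published
yet"; cell GAPS G-t4-U2-1, G-t4-U2-2), consumed as a binder; nothing of Bałaban's (1.22) is asserted or constructed; row D4 class UNCHANGED
(critical-path width 0; instance 0∕1; D4 DISCHARGE NO DATE); NOT B12 Thm 2, NOT BetaPertH, NOT continuum, NOT Clay.  HONEST DEPENDENCY:
continuum YM on T⁴ ⇐ BetaPertH ∧ nine spine estimates (0/9 proved); BetaPertH ⇐ (D1) ∧ (D4) ∧ CAP+tail; G-an2-4 gates asym, D1 and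
NE2/3/4.  ABSOLUTE RULE: nothing is cited as a fact.

WHAT IS PROVED ([folklore]; 0 sorry; 0 `def`).
* §1 `sum_Ico_le_of_partial` (windows of a nonnegative profile are `≤ W`); **`disc_le_apriori`** (one pinned pair of runs, scale-shift
  profile `Σσ ≤ S`, moduli `0 ≤ Λ l i ≤ ρ(l−i)` with `Σρ ≤ W`, AF weight sum `≤ U`, `WU < 1` ⟹ `disc gA gB j ≤ S∕(1 − WU)` for all `j ≤ K`:
  the maximal discrepancy obeys `D ≤ S + D·W·U` by `disc_le_sum` + `feedback_le_column`).
* §2 `weight_le_eventual` (`(g^A_i)²g^B_{i+1} ≤ 1∕(a_{K−i}√a_{K−i})` for `k₀ ≤ i ≤ K` under `EventualLowerH`), `weight_le_cube` (`≤ γ³` always),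
  `sum_uvBlock_le` (`Σ_{l<n} Σ_{i≤l, i<k₀} Λ l i ≤ k₀·W`).
* §3 **`disc_le_column_eventual`**: the column-form recursion of the kernel with the source `σ_l + (S∕(1−WU))·γ³·Σ_{i≤l, i<k₀} Λ l i` and the
  infrared-distance weights on ALL remaining columns.
* §4 ENDs **`sum_disc_diag_le_eventual`** (`Σ_{n<N} disc (g (n+m)) (g (n+m+1)) n ≤ m·(S + k₀Wγ³S∕(1 − WU))∕(1 − Wγ∕b)`, `U = (k₀+1)γ³ + 2γ∕b`,
  ONE smallness `W·U < 1`, which implies `Wγ < b`) and **`tendsto_invSq_diag_eventual`** (`invSq g m n → astar g m` at every scale) — the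
  binder list of node U2's `injectedRate_of_runs_eventual` with `ScaleShiftRate` ∕ `FadingMemory` weakened to summable profiles.
All letters NOT-IN-PRINT; `BetaFlowAsPrinted S` records a Markov β_n only ⇒ no junction of the as-printed interface changes.
-/

noncomputable section

open Finset Filter Topology

namespace Summit.QuantumFields.BalabanUV.Beta.RemainderExplicitHistoryDiagonalEventual

open Literature.MathematicalPhysics.QuantumFieldTheory.Balaban1983to89
open Literature.MathematicalPhysics.QuantumFieldTheory.Balaban1983to89.FlowStep
open Literature.MathematicalPhysics.QuantumFieldTheory.Balaban1983to89.T4CouplingMatching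
open Literature.MathematicalPhysics.QuantumFieldTheory.Balaban1983to89.T4ContinuumCoupling
open Summit.QuantumFields.BalabanUV.Beta.RemainderExplicitHistoryDiagonalSum
open Summit.QuantumFields.BalabanUV.Beta.RemainderExplicitHistoryDiagonalExistence

/-! ## §1 The a-priori sup bound over one pinned pair of runs -/

/-- Windows of a nonnegative profile with partial sums `≤ W` are `≤ W`. [folklore] -/
theorem sum_Ico_le_of_partial {ρ : ℕ → ℝ} {W : ℝ} (hρ0 : ∀ a, 0 ≤ ρ a) (hρW : ∀ n, ∑ a ∈ range n, ρ a ≤ W)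
    (A B : ℕ) : ∑ a ∈ Ico A B, ρ a ≤ W :=
  (Finset.sum_le_sum_of_subset_of_nonneg (fun _ ha => Finset.mem_range.mpr (Finset.mem_Ico.mp ha).2)
    (fun a _ _ => hρ0 a)).trans (hρW B)

/-- **A-PRIORI SUP BOUND.**  One pinned pair of runs of (0.20) (A: `K` steps, B: `K + 1` steps, ]0,γ], `g^A_K = g^B_{K+1}`), scale-shift
profile `Σ_{l<n} σ_l ≤ S`, moduli `0 ≤ Λ l i ≤ ρ(l − i)` with `Σ_{a<n} ρ_a ≤ W`, AF weight sum `Σ_{i≤K} (g^A_i)²g^B_{i+1} ≤ U`, smallness `W·U < 1`: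
then `disc gA gB j ≤ S∕(1 − WU)` for every `j ≤ K` (the maximal discrepancy `D` satisfies `D ≤ S + D·W·U`).  Cruder than node U2's
`disc_le_of_fadingMemory` (no decay in `j`) but free of every geometric shape. [cite: Balaban1987RG1, (0.20) p.256 and Thm 2 p.259] -/
theorem disc_le_apriori {β : HBeta} {γ S W U : ℝ} {σ ρ : ℕ → ℝ} {Λ : ℕ → ℕ → ℝ} {K : ℕ} {gA gB : ℕ → ℝ}
    (hA : RGEqH K β gA) (hB : RGEqH (K + 1) β gB)
    (hAbox : ∀ i, i ≤ K → 0 < gA i ∧ gA i ≤ γ) (hBbox : ∀ i, i ≤ K + 1 → 0 < gB i ∧ gB i ≤ γ) (hpin : gA K = gB (K + 1))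
    (hS : ∀ k (w : Fin (k + 2) → ℝ), w ∈ Box γ (k + 1) → |β (k + 1) w - β k (Fin.tail w)| ≤ σ k)
    (hL : HistLipschitz Λ γ β) (hΛ0 : ∀ k i, i ≤ k → 0 ≤ Λ k i) (hΛρ : ∀ k i, i ≤ k → Λ k i ≤ ρ (k - i))
    (hσ0 : ∀ l, 0 ≤ σ l) (hρ0 : ∀ a, 0 ≤ ρ a) (hσS : ∀ n, ∑ l ∈ range n, σ l ≤ S) (hρW : ∀ n, ∑ a ∈ range n, ρ a ≤ W)
    (hU : ∑ i ∈ range (K + 1), (gA i) ^ 2 * gB (i + 1) ≤ U) (hq : W * U < 1) {j : ℕ} (hj : j ≤ K) :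
    disc gA gB j ≤ S / (1 - W * U) := by
  classical
  have hW0 : 0 ≤ W := by simpa using hρW 0
  have hw0 : ∀ i, i < K + 1 → 0 ≤ (gA i) ^ 2 * gB (i + 1) := fun i hi => by
    have h1 := (hBbox (i + 1) (by omega)).1
    positivity
  obtain ⟨j₀, hj₀, hmax⟩ := Finset.exists_max_image (range (K + 1)) (disc gA gB) ⟨0, by simp⟩
  set D := disc gA gB j₀ with hD
  have hDi : ∀ i, i ≤ K → disc gA gB i ≤ D := fun i hi => hmax i (Finset.mem_range.mpr (Nat.lt_succ_of_le hi))
  have hD0 : 0 ≤ D := disc_nonneg _ _ _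
  have hj₀K : j₀ ≤ K := Nat.lt_succ_iff.mp (Finset.mem_range.mp hj₀)
  have key : D ≤ S + D * (W * U) := by
    have h := disc_le_sum hA hB hAbox hBbox hpin hS hL hΛ0 hj₀K
    have h1 : ∑ l ∈ Ico j₀ K, σ l ≤ S := sum_Ico_le_of_partial hσ0 hσS j₀ K
    have h2 := feedback_le_column (K := K) (j := j₀) (δ := fun i => disc gA gB i)
      (w := fun i => (gA i) ^ 2 * gB (i + 1)) hΛρ (fun i hi => hw0 i (by omega)) (fun i => disc_nonneg _ _ _)
    have h3 : ∑ i ∈ range K, (∑ a ∈ Ico (j₀ - i) (K - i), ρ a) * ((gA i) ^ 2 * gB (i + 1)) * disc gA gB i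
        ≤ ∑ i ∈ range K, W * ((gA i) ^ 2 * gB (i + 1)) * D := by
      refine Finset.sum_le_sum fun i hi => ?_
      have hiK := Finset.mem_range.mp hi
      exact mul_le_mul (mul_le_mul_of_nonneg_right (sum_Ico_le_of_partial hρ0 hρW _ _) (hw0 i (by omega)))
        (hDi i hiK.le) (disc_nonneg _ _ _) (mul_nonneg hW0 (hw0 i (by omega)))
    have h4 : ∑ i ∈ range K, W * ((gA i) ^ 2 * gB (i + 1)) * D ≤ D * (W * U) := by
      rw [show ∑ i ∈ range K, W * ((gA i) ^ 2 * gB (i + 1)) * D = (W * D) * ∑ i ∈ range K, (gA i) ^ 2 * gB (i + 1) by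
        rw [Finset.mul_sum]; exact Finset.sum_congr rfl fun i _ => by ring]
      have h5 : ∑ i ∈ range K, (gA i) ^ 2 * gB (i + 1) ≤ U := by
        refine le_trans ?_ hU
        exact Finset.sum_le_sum_of_subset_of_nonneg (Finset.range_mono (Nat.le_succ K))
          fun i hi _ => hw0 i (Finset.mem_range.mp hi)
      nlinarith [mul_nonneg hW0 hD0]
    linarith
  have hq' : 0 < 1 - W * U := by linarith
  have hDle : D ≤ S / (1 - W * U) := by
    rw [le_div_iff₀ hq']
    nlinarith
  exact (hDi j hj).trans hDle

/-! ## §2 Eventual weights and the ultraviolet block -/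

/-- The AF weight at infrared distance `K − i` under the EVENTUAL floor: for `k₀ ≤ i ≤ K`, `(g^A_i)²g^B_{i+1} ≤ 1∕(a_{K−i}√a_{K−i})`
(`inv_sq_lower_of_eventualLower` BY NAME for both runs). [cite: Balaban1987RG1, (0.31) p.259] -/
theorem weight_le_eventual {β : HBeta} {γ b : ℝ} {k₀ K : ℕ} {gA gB : ℕ → ℝ} (hγ : 0 < γ) (hb : 0 < b)
    (hA : RGEqH K β gA) (hB : RGEqH (K + 1) β gB)
    (hAbox : ∀ i, i ≤ K → 0 < gA i ∧ gA i ≤ γ) (hBbox : ∀ i, i ≤ K + 1 → 0 < gB i ∧ gB i ≤ γ)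
    (hlo : EventualLowerH b γ k₀ β) {i : ℕ} (hk : k₀ ≤ i) (hi : i ≤ K) :
    (gA i) ^ 2 * gB (i + 1) ≤ 1 / (prof γ b (K - i) * sprof γ b (K - i)) := by
  have hp0 := prof_pos hγ hb.le (K - i)
  have hs0 := sprof_pos hγ hb.le (K - i)
  have hgA := hAbox i hi
  have hgB := hBbox (i + 1) (by omega)
  have hgAK := hAbox K le_rfl
  have hgBK := hBbox (K + 1) le_rfl
  have hAK : 1 / γ ^ 2 ≤ 1 / (gA K) ^ 2 :=
    one_div_le_one_div_of_le (pow_pos hgAK.1 2) (pow_le_pow_left₀ hgAK.1.le hgAK.2 2)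
  have hBK : 1 / γ ^ 2 ≤ 1 / (gB (K + 1)) ^ 2 :=
    one_div_le_one_div_of_le (pow_pos hgBK.1 2) (pow_le_pow_left₀ hgBK.1.le hgBK.2 2)
  have h1 := inv_sq_lower_of_eventualLower hA hAbox hlo hk hi
  have h2 := inv_sq_lower_of_eventualLower hB hBbox hlo (i := i + 1) (by omega) (by omega)
  have hKi : ((K + 1 - (i + 1) : ℕ) : ℝ) = ((K - i : ℕ) : ℝ) := by rw [Nat.add_sub_add_right]
  rw [hKi] at h2
  have haA : prof γ b (K - i) ≤ 1 / (gA i) ^ 2 := by unfold prof; linarith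
  have haB : prof γ b (K - i) ≤ 1 / (gB (i + 1)) ^ 2 := by unfold prof; linarith
  have hsqA : (gA i) ^ 2 ≤ 1 / prof γ b (K - i) := by
    rw [le_one_div (pow_pos hgA.1 2) hp0]; exact haA
  have hsqB : (gB (i + 1)) ^ 2 ≤ (1 / sprof γ b (K - i)) ^ 2 := by
    rw [one_div_pow, sprof_sq hγ hb.le, le_one_div (pow_pos hgB.1 2) hp0]; exact haB
  have hB' : gB (i + 1) ≤ 1 / sprof γ b (K - i) :=
    (pow_le_pow_iff_left₀ hgB.1.le (one_div_pos.mpr hs0).le two_ne_zero).mp hsqB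
  calc (gA i) ^ 2 * gB (i + 1) ≤ (1 / prof γ b (K - i)) * (1 / sprof γ b (K - i)) :=
        mul_le_mul hsqA hB' hgB.1.le (one_div_pos.mpr hp0).le
    _ = 1 / (prof γ b (K - i) * sprof γ b (K - i)) := by rw [one_div_mul_one_div]

/-- The box alone: `(g^A_i)²g^B_{i+1} ≤ γ³`. [folklore] -/
theorem weight_le_cube {γ : ℝ} {K : ℕ} {gA gB : ℕ → ℝ}
    (hAbox : ∀ i, i ≤ K → 0 < gA i ∧ gA i ≤ γ) (hBbox : ∀ i, i ≤ K + 1 → 0 < gB i ∧ gB i ≤ γ) {i : ℕ} (hi : i ≤ K) :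
    (gA i) ^ 2 * gB (i + 1) ≤ γ ^ 3 := by
  have hgA := hAbox i hi
  have hgB := hBbox (i + 1) (by omega)
  calc (gA i) ^ 2 * gB (i + 1) ≤ γ ^ 2 * γ :=
        mul_le_mul (pow_le_pow_left₀ hgA.1.le hgA.2 2) hgB.2 hgB.1.le (sq_nonneg γ)
    _ = γ ^ 3 := by ring

/-- THE ULTRAVIOLET BLOCK IS A SUMMABLE SOURCE: `Σ_{l<n} Σ_{i≤l, i<k₀} Λ l i ≤ k₀·W` (the `k₀` finest couplings are felt by all later scales
with total weight `≤ W` each). [folklore] -/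
theorem sum_uvBlock_le {Λ : ℕ → ℕ → ℝ} {ρ : ℕ → ℝ} {W : ℝ} {k₀ : ℕ}
    (hΛρ : ∀ l i, i ≤ l → Λ l i ≤ ρ (l - i)) (hρW : ∀ n, ∑ a ∈ range n, ρ a ≤ W) (n : ℕ) :
    ∑ l ∈ range n, ∑ i ∈ range (l + 1), (if i < k₀ then Λ l i else 0) ≤ (k₀ : ℝ) * W := by
  classical
  have hstep : ∀ l, ∑ i ∈ range (l + 1), (if i < k₀ then Λ l i else 0)
      ≤ ∑ i ∈ range k₀, (if i ≤ l then ρ (l - i) else 0) := by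
    intro l
    rw [← Finset.sum_filter, ← Finset.sum_filter]
    have hset : (range (l + 1)).filter (fun i => i < k₀) = (range k₀).filter (fun i => i ≤ l) := by
      ext i; simp only [Finset.mem_filter, Finset.mem_range]; omega
    rw [hset]
    exact Finset.sum_le_sum fun i hi => hΛρ l i (Finset.mem_filter.mp hi).2
  refine (Finset.sum_le_sum fun l _ => hstep l).trans ?_
  rw [Finset.sum_comm]
  have hcol : ∀ i ∈ range k₀, ∑ l ∈ range n, (if i ≤ l then ρ (l - i) else 0) ≤ W := by
    intro i _
    rw [← Finset.sum_filter]
    have hset : (range n).filter (fun l => i ≤ l) = Ico i n := by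
      ext l; simp only [Finset.mem_filter, Finset.mem_range, Finset.mem_Ico]; omega
    rw [hset, Finset.sum_Ico_eq_sum_range]
    calc ∑ k ∈ range (n - i), ρ (i + k - i) = ∑ k ∈ range (n - i), ρ k :=
          Finset.sum_congr rfl fun k _ => by rw [Nat.add_sub_cancel_left]
      _ ≤ W := hρW _
  calc ∑ i ∈ range k₀, ∑ l ∈ range n, (if i ≤ l then ρ (l - i) else 0) ≤ ∑ _i ∈ range k₀, W :=
        Finset.sum_le_sum hcol
    _ = (k₀ : ℝ) * W := by rw [Finset.sum_const, Finset.card_range, nsmul_eq_mul]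

/-! ## §3 The column-form recursion under the eventual floor -/

/-- **THE COLUMN-FORM RECURSION WITH THE ULTRAVIOLET BLOCK IN THE SOURCE.**  One pinned pair of runs under `EventualLowerH b γ k₀ β` and the
binders of `disc_le_apriori`: for every `j ≤ K`,
`δ_j ≤ Σ_{l∈[j,K)} (σ_l + (S∕(1−WU))·γ³·Σ_{i≤l, i<k₀} Λ l i) + Σ_{i<K} (Σ_{a∈[j∸i,K−i)} ρ_a)·u_{K−i}·δ_i` with `u_n = 1∕(a_n√a_n)` — the shape
consumed by `RemainderExplicitHistoryDiagonalKernel.diag_sum_le`. [cite: Balaban1987RG1, (0.20) p.256, (0.31) and Thm 2 p.259] -/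
theorem disc_le_column_eventual {β : HBeta} {γ b S W U : ℝ} {σ ρ : ℕ → ℝ} {Λ : ℕ → ℕ → ℝ} {k₀ K : ℕ} {gA gB : ℕ → ℝ}
    (hγ : 0 < γ) (hb : 0 < b) (hA : RGEqH K β gA) (hB : RGEqH (K + 1) β gB)
    (hAbox : ∀ i, i ≤ K → 0 < gA i ∧ gA i ≤ γ) (hBbox : ∀ i, i ≤ K + 1 → 0 < gB i ∧ gB i ≤ γ) (hpin : gA K = gB (K + 1))
    (hS : ∀ k (w : Fin (k + 2) → ℝ), w ∈ Box γ (k + 1) → |β (k + 1) w - β k (Fin.tail w)| ≤ σ k)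
    (hL : HistLipschitz Λ γ β) (hΛ0 : ∀ k i, i ≤ k → 0 ≤ Λ k i) (hΛρ : ∀ k i, i ≤ k → Λ k i ≤ ρ (k - i))
    (hσ0 : ∀ l, 0 ≤ σ l) (hρ0 : ∀ a, 0 ≤ ρ a) (hσS : ∀ n, ∑ l ∈ range n, σ l ≤ S) (hρW : ∀ n, ∑ a ∈ range n, ρ a ≤ W)
    (hlo : EventualLowerH b γ k₀ β) (hU : ∑ i ∈ range (K + 1), (gA i) ^ 2 * gB (i + 1) ≤ U) (hq : W * U < 1)
    {j : ℕ} (hj : j ≤ K) :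
    disc gA gB j ≤ (∑ l ∈ Ico j K, (σ l + S / (1 - W * U) * γ ^ 3 * ∑ i ∈ range (l + 1), (if i < k₀ then Λ l i else 0)))
      + ∑ i ∈ range K, (∑ a ∈ Ico (j - i) (K - i), ρ a) * (1 / (prof γ b (K - i) * sprof γ b (K - i)))
          * disc gA gB i := by
  classical
  set Dbar := S / (1 - W * U) with hDbar
  have hDb : ∀ i, i ≤ K → disc gA gB i ≤ Dbar := fun i hi =>
    disc_le_apriori hA hB hAbox hBbox hpin hS hL hΛ0 hΛρ hσ0 hρ0 hσS hρW hU hq hi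
  have hγ3 : 0 ≤ γ ^ 3 := pow_nonneg hγ.le 3
  have hS0 : 0 ≤ S := by simpa using hσS 0
  have hDbar0 : 0 ≤ Dbar := by
    have : 0 < 1 - W * U := by linarith
    positivity
  have h := disc_le_sum hA hB hAbox hBbox hpin hS hL hΛ0 hj
  -- split each inner feedback sum at `k₀`
  have hsplit : ∀ l ∈ Ico j K, ∑ i ∈ range (l + 1), Λ l i * ((gA i) ^ 2 * gB (i + 1)) * disc gA gB i
      ≤ Dbar * γ ^ 3 * (∑ i ∈ range (l + 1), (if i < k₀ then Λ l i else 0))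
        + ∑ i ∈ range (l + 1), (if i < k₀ then 0 else Λ l i)
            * (if i < k₀ then 0 else (gA i) ^ 2 * gB (i + 1)) * disc gA gB i := by
    intro l hl
    have hlK : l < K := (Finset.mem_Ico.mp hl).2
    rw [Finset.mul_sum, ← Finset.sum_add_distrib]
    refine Finset.sum_le_sum fun i hi => ?_
    have hil : i ≤ l := Nat.lt_succ_iff.mp (Finset.mem_range.mp hi)
    have hiK : i ≤ K := by omega
    by_cases hik : i < k₀
    · simp only [if_pos hik, zero_mul, add_zero]
      have h1 : Λ l i * ((gA i) ^ 2 * gB (i + 1)) * disc gA gB i ≤ Λ l i * γ ^ 3 * Dbar :=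
        mul_le_mul (mul_le_mul_of_nonneg_left (weight_le_cube hAbox hBbox hiK) (hΛ0 l i hil)) (hDb i hiK)
          (disc_nonneg _ _ _) (mul_nonneg (hΛ0 l i hil) hγ3)
      linarith
    · simp only [if_neg hik, mul_zero, zero_add]
      exact le_rfl
  have h2 : ∑ l ∈ Ico j K, ∑ i ∈ range (l + 1), Λ l i * ((gA i) ^ 2 * gB (i + 1)) * disc gA gB i
      ≤ (∑ l ∈ Ico j K, Dbar * γ ^ 3 * ∑ i ∈ range (l + 1), (if i < k₀ then Λ l i else 0))
        + ∑ l ∈ Ico j K, ∑ i ∈ range (l + 1), (if i < k₀ then 0 else Λ l i)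
            * (if i < k₀ then 0 else (gA i) ^ 2 * gB (i + 1)) * disc gA gB i := by
    rw [← Finset.sum_add_distrib]
    exact Finset.sum_le_sum hsplit
  -- the remaining columns in column form, with the infrared-distance weights
  have h3 : ∑ l ∈ Ico j K, ∑ i ∈ range (l + 1), (if i < k₀ then 0 else Λ l i)
        * (if i < k₀ then 0 else (gA i) ^ 2 * gB (i + 1)) * disc gA gB i
      ≤ ∑ i ∈ range K, (∑ a ∈ Ico (j - i) (K - i), ρ a) * (1 / (prof γ b (K - i) * sprof γ b (K - i)))
          * disc gA gB i := by
    refine (feedback_le_column (Λ := fun l i => if i < k₀ then 0 else Λ l i) (ρ := ρ) (K := K) (j := j)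
      (δ := fun i => disc gA gB i) (w := fun i => if i < k₀ then 0 else (gA i) ^ 2 * gB (i + 1))
      (fun l i hil => ?_) (fun i hi => ?_) (fun i => disc_nonneg _ _ _)).trans (Finset.sum_le_sum fun i hi => ?_)
    · show (if i < k₀ then 0 else Λ l i) ≤ ρ (l - i)
      split_ifs
      · exact hρ0 _
      · exact hΛρ l i hil
    · show 0 ≤ (if i < k₀ then 0 else (gA i) ^ 2 * gB (i + 1))
      split_ifs
      · exact le_rfl
      · have := (hBbox (i + 1) (by omega)).1; positivity
    · have hiK := Finset.mem_range.mp hi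
      refine mul_le_mul_of_nonneg_right (mul_le_mul_of_nonneg_left ?_ (Finset.sum_nonneg fun a _ => hρ0 a))
        (disc_nonneg _ _ _)
      show (if i < k₀ then 0 else (gA i) ^ 2 * gB (i + 1)) ≤ 1 / (prof γ b (K - i) * sprof γ b (K - i))
      split_ifs with hik
      · exact weight_nonneg hγ hb.le _
      · exact weight_le_eventual hγ hb hA hB hAbox hBbox hlo (not_lt.mp hik) hiK.le
  have h4 : (∑ l ∈ Ico j K, σ l) + ∑ l ∈ Ico j K, Dbar * γ ^ 3 * ∑ i ∈ range (l + 1), (if i < k₀ then Λ l i else 0)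
      = ∑ l ∈ Ico j K, (σ l + Dbar * γ ^ 3 * ∑ i ∈ range (l + 1), (if i < k₀ then Λ l i else 0)) := by
    rw [← Finset.sum_add_distrib]
  linarith [h, h2, h3, h4]

/-! ## §4 END under the eventual floor -/

/-- **ROAD P3 — SUMMABLE DISCREPANCIES ALONG EVERY DIAGONAL UNDER THE EVENTUAL FLOOR, WITHOUT NE4 AS TYPED AND WITHOUT FADING MEMORY.**  A
family of runs `K ↦ g K` of (0.20) in ]0,γ] pinned at `g_IR`; scale-shift profile `Σ_{l<n} σ_l ≤ S`; moduli `0 ≤ Λ k i ≤ ρ(k − i)`,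
`Σ_{a<n} ρ_a ≤ W`; the EVENTUAL floor `EventualLowerH b γ k₀ β` (`b > 0`); ONE smallness `W·U < 1` with `U = (k₀+1)γ³ + 2γ∕b` (node U2's
K-uniform weight sum, `sum_weights_le_of_eventualLower` BY NAME; it implies `Wγ < b`).  THEN for every infrared distance `m` and every `N`:
`Σ_{n<N} disc (g (n+m)) (g (n+m+1)) n ≤ m·(S + k₀·W·γ³·S∕(1 − WU))∕(1 − Wγ∕b)`. [cite: Balaban1987RG1, (0.20) p.256, (0.31) and Thm 2 p.259] -/
theorem sum_disc_diag_le_eventual {β : HBeta} {γ b S W : ℝ} {σ ρ : ℕ → ℝ} {Λ : ℕ → ℕ → ℝ} {k₀ : ℕ} (g : ℕ → ℕ → ℝ)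
    (gIR : ℝ) (hγ : 0 < γ) (hb : 0 < b) (hσ0 : ∀ l, 0 ≤ σ l) (hρ0 : ∀ a, 0 ≤ ρ a)
    (hσS : ∀ n, ∑ l ∈ range n, σ l ≤ S) (hρW : ∀ n, ∑ a ∈ range n, ρ a ≤ W)
    (hsmall : W * (((k₀ : ℝ) + 1) * γ ^ 3 + 2 * γ / b) < 1)
    (hrun : ∀ K, RGEqH K β (g K)) (hbox : ∀ K i, i ≤ K → 0 < g K i ∧ g K i ≤ γ) (hpin : ∀ K, g K K = gIR)
    (hS : ∀ k (w : Fin (k + 2) → ℝ), w ∈ Box γ (k + 1) → |β (k + 1) w - β k (Fin.tail w)| ≤ σ k)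
    (hL : HistLipschitz Λ γ β) (hΛ0 : ∀ k i, i ≤ k → 0 ≤ Λ k i) (hΛρ : ∀ k i, i ≤ k → Λ k i ≤ ρ (k - i))
    (hlo : EventualLowerH b γ k₀ β) (m N : ℕ) :
    ∑ n ∈ range N, disc (g (n + m)) (g (n + m + 1)) n
      ≤ (m : ℝ) * (S + (k₀ : ℝ) * W * γ ^ 3 * (S / (1 - W * (((k₀ : ℝ) + 1) * γ ^ 3 + 2 * γ / b))))
          / (1 - W * γ / b) := by
  set U : ℝ := ((k₀ : ℝ) + 1) * γ ^ 3 + 2 * γ / b with hU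
  have hW0 : 0 ≤ W := by simpa using hρW 0
  have hS0 : 0 ≤ S := by simpa using hσS 0
  have hγ3 : 0 ≤ γ ^ 3 := pow_nonneg hγ.le 3
  have hq : W * U < 1 := hsmall
  have hqγ : W * (γ / b) < 1 := by
    have h1 : γ / b ≤ U := by
      rw [hU]
      have : 0 ≤ ((k₀ : ℝ) + 1) * γ ^ 3 := by positivity
      have : 0 ≤ γ / b := by positivity
      have e : 2 * γ / b = 2 * (γ / b) := by ring
      linarith
    nlinarith [mul_le_mul_of_nonneg_left h1 hW0]
  have hDbar0 : 0 ≤ S / (1 - W * U) := div_nonneg hS0 (by linarith)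
  -- the modified source and its partial sums
  have hsrc0 : ∀ l, 0 ≤ σ l + S / (1 - W * U) * γ ^ 3 * ∑ i ∈ range (l + 1), (if i < k₀ then Λ l i else 0) := by
    intro l
    refine add_nonneg (hσ0 l) (mul_nonneg (mul_nonneg hDbar0 hγ3) (Finset.sum_nonneg fun i hi => ?_))
    split_ifs
    · exact hΛ0 l i (Nat.lt_succ_iff.mp (Finset.mem_range.mp hi))
    · exact le_rfl
  have hsrcS : ∀ n, ∑ l ∈ range n, (σ l + S / (1 - W * U) * γ ^ 3 * ∑ i ∈ range (l + 1), (if i < k₀ then Λ l i else 0))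
      ≤ S + (k₀ : ℝ) * W * γ ^ 3 * (S / (1 - W * U)) := by
    intro n
    rw [Finset.sum_add_distrib, ← Finset.mul_sum]
    have h1 := hσS n
    have h2 := sum_uvBlock_le (k₀ := k₀) hΛρ hρW n
    have h3 : S / (1 - W * U) * γ ^ 3 * ∑ l ∈ range n, ∑ i ∈ range (l + 1), (if i < k₀ then Λ l i else 0)
        ≤ S / (1 - W * U) * γ ^ 3 * ((k₀ : ℝ) * W) := mul_le_mul_of_nonneg_left h2 (mul_nonneg hDbar0 hγ3)
    linarith
  have hrec : ∀ K j, j ≤ K → disc (g K) (g (K + 1)) j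
      ≤ (∑ l ∈ Ico j K, (σ l + S / (1 - W * U) * γ ^ 3 * ∑ i ∈ range (l + 1), (if i < k₀ then Λ l i else 0)))
        + ∑ i ∈ range K, (∑ a ∈ Ico (j - i) (K - i), ρ a) * (1 / (prof γ b (K - i) * sprof γ b (K - i)))
            * disc (g K) (g (K + 1)) i := fun K j hj =>
    disc_le_column_eventual hγ hb (hrun K) (hrun (K + 1)) (hbox K) (hbox (K + 1)) ((hpin K).trans (hpin (K + 1)).symm)
      hS hL hΛ0 hΛρ hσ0 hρ0 hσS hρW hlo
      (sum_weights_le_of_eventualLower hγ hb (hrun K) (hrun (K + 1)) (hbox K) (hbox (K + 1)) hlo) hq hj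
  have h := RemainderExplicitHistoryDiagonalKernel.diag_sum_le (δ := fun K j => disc (g K) (g (K + 1)) j)
    (fun K j => disc_nonneg _ _ _) hsrc0 hρ0 (weight_nonneg hγ hb.le) hsrcS hρW (nat_mul_weight_le hγ hb) hqγ hrec m N
  rw [mul_div_assoc W γ b]
  exact h

/-- **ROAD P3 — THE CONTINUUM RECURSION VARIABLE EXISTS AT EVERY SCALE UNDER THE EVENTUAL FLOOR, WITHOUT NE4 AS TYPED AND WITHOUT FADING
MEMORY**: under the binders of `sum_disc_diag_le_eventual`, `invSq g m n → astar g m` for every `m`, with the uniform closeness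
`|invSq g m n − astar g m| ≤ m·(S + k₀Wγ³S∕(1 − WU))∕(1 − Wγ∕b)` — node U2 v1.1's binder list (`injectedRate_of_runs_eventual`) with
`ScaleShiftRate` ∕ `FadingMemory` weakened to summable profiles; existence, no rate. [cite: Balaban1987RG1, (0.20) p.256 and Thm 2 p.259] -/
theorem tendsto_invSq_diag_eventual {β : HBeta} {γ b S W : ℝ} {σ ρ : ℕ → ℝ} {Λ : ℕ → ℕ → ℝ} {k₀ : ℕ} (g : ℕ → ℕ → ℝ)
    (gIR : ℝ) (hγ : 0 < γ) (hb : 0 < b) (hσ0 : ∀ l, 0 ≤ σ l) (hρ0 : ∀ a, 0 ≤ ρ a)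
    (hσS : ∀ n, ∑ l ∈ range n, σ l ≤ S) (hρW : ∀ n, ∑ a ∈ range n, ρ a ≤ W)
    (hsmall : W * (((k₀ : ℝ) + 1) * γ ^ 3 + 2 * γ / b) < 1)
    (hrun : ∀ K, RGEqH K β (g K)) (hbox : ∀ K i, i ≤ K → 0 < g K i ∧ g K i ≤ γ) (hpin : ∀ K, g K K = gIR)
    (hS : ∀ k (w : Fin (k + 2) → ℝ), w ∈ Box γ (k + 1) → |β (k + 1) w - β k (Fin.tail w)| ≤ σ k)
    (hL : HistLipschitz Λ γ β) (hΛ0 : ∀ k i, i ≤ k → 0 ≤ Λ k i) (hΛρ : ∀ k i, i ≤ k → Λ k i ≤ ρ (k - i))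
    (hlo : EventualLowerH b γ k₀ β) (m : ℕ) :
    Tendsto (invSq g m) atTop (𝓝 (astar g m))
      ∧ ∀ n, |invSq g m n - astar g m|
          ≤ (m : ℝ) * (S + (k₀ : ℝ) * W * γ ^ 3 * (S / (1 - W * (((k₀ : ℝ) + 1) * γ ^ 3 + 2 * γ / b))))
              / (1 - W * γ / b) := by
  have hB := sum_disc_diag_le_eventual g gIR hγ hb hσ0 hρ0 hσS hρW hsmall hrun hbox hpin hS hL hΛ0 hΛρ hlo
  exact ⟨tendsto_invSq_of_diag_le hB m, abs_invSq_sub_astar_le_of_diag_le hB m⟩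

end Summit.QuantumFields.BalabanUV.Beta.RemainderExplicitHistoryDiagonalEventual

end
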